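import Literature.Probability.RandomPlanarGeometry.SLEExistence
import Literature.Probability.RandomPlanarGeometry.CaratheodoryHalfPlaneProofs
import HarnessLib

/-!
# Existence of chordal SLE as a random curve: the reduction to the SLE trace theorems

Trunk T-STOCH. The named fact `Literature.Probability.RandomPlanarGeometry.exists_isSLECurve`
(`Literature/Probability/RandomPlanarGeometry/SLE.lean`: for `κ > 0` and a Dobrushin domain
`(D; a, b)`, the time-compactified image of the chordal SLE_κ trace under a chordal uniformizing
map is an a.e.-measurable random curve, `IsSLECurve κ D Γ`) was reduced in `SLEExistence.lean`
(`Literature.Probability.RandomPlanarGeometry.exists_isSLECurve_of_aemeasurable_sleTrace`) to six named facts. The two function-theoretic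
ones are now theorems of the tree (`CaratheodoryHalfPlaneProofs.lean`: chordal uniformizing
maps exist, `MarkedDomain.exists_isChordalUniformizing_holds`, and the half-plane boundary
extension is continuous, `JordanDomain.continuousOn_boundaryExtension_holds` — Riemann mapping
theorem, Runge/simple connectivity of Jordan domains, Carathéodory's continuity theorem via
length–area and Janiszewski, all proved, no Jordan curve theorem), so that

* `Literature.Probability.RandomPlanarGeometry.exists_isSLECurve_of_sle_facts` : `hasSLETrace_eight → hasSLETrace_of_ne_eight →
    tendsto_norm_sleTrace_atTop → aemeasurable_sleTrace → exists_isSLECurve`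

leaves `Literature.Probability.RandomPlanarGeometry.exists_isSLECurve` resting on exactly the four SLE trace theorems:
SLE₈ is generated by a curve (Lawler–Schramm–Werner, Ann. Probab. 32 (2004), Thm. 4.7),
SLE_κ (`κ ≠ 8`) is generated by a curve (Rohde–Schramm, Ann. Math. 161 (2005), Thm. 5.1),
transience of the trace (Rohde–Schramm Thm. 7.1) and measurability of the trace marginals
(Rohde–Schramm §3 p. 896) — each a theory (stochastic calculus for the Loewner flow) absent
from Mathlib.

## References

* S. Rohde, O. Schramm, Basic properties of SLE, Ann. of Math. 161 (2005) 883–924, Thms 5.1, 7.1.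
* G. F. Lawler, O. Schramm, W. Werner, Conformal invariance of planar loop-erased random walks
  and uniform spanning trees, Ann. Probab. 32 (2004), Thm. 4.7.
-/

noncomputable section

namespace Literature.Probability.RandomPlanarGeometry

/-- **Existence of chordal SLE_κ in Dobrushin domains from the SLE trace theorems alone.**
`Literature.Probability.RandomPlanarGeometry.exists_isSLECurve` follows from: SLE₈ generated by a curve (`hasSLETrace_eight`, LSW 2004
Thm. 4.7), SLE_κ generated by a curve for `κ ≠ 8` (`hasSLETrace_of_ne_eight`, Rohde–Schramm 2005
Thm. 5.1), transience (`tendsto_norm_sleTrace_atTop`, RS05 Thm. 7.1) and measurability of the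
trace marginals (`aemeasurable_sleTrace`, RS05 §3); the uniformizing map and its continuous
boundary extension are supplied by `MarkedDomain.exists_isChordalUniformizing_holds` and
`JordanDomain.continuousOn_boundaryExtension_holds`. Rohde–Schramm, Ann. Math. 161 (2005),
Thm 5.1 and Thm 7.1. [cite: RohdeSchramm2005, Thm 5.1 and Thm 7.1] -/
theorem exists_isSLECurve_of_sle_facts (h8 : hasSLETrace_eight) (hne : hasSLETrace_of_ne_eight)
    (htr : tendsto_norm_sleTrace_atTop) (hmeas : aemeasurable_sleTrace) : exists_isSLECurve :=
  exists_isSLECurve_of_aemeasurable_sleTrace h8 hne htr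
    MarkedDomain.exists_isChordalUniformizing_holds
    JordanDomain.continuousOn_boundaryExtension_holds hmeas

end Literature.Probability.RandomPlanarGeometry
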